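import Summits.QuantumFields.YangMills.Theorems.BalabanUVNodesN12FlatHndConnLetter
import HarnessLib

/-!
# BalabanUVNodes ∕ N12 — (β)♭: print's (1.19) FOR THE RECORD's `𝐁_k(Z)`, LINEARISED AT THE FLAT CONFIGURATION — every fine field has a `𝐁_k(Z)`-ADAPTED HIERARCHICAL AXIAL
# representative modulo a pure gauge whose potential VANISHES AT EVERY MEMBER CENTRE (existence), and such a representative is unique (uniqueness: a top-pinned pure gauge in the slice is `0`)

Cell `pub-ymgap` (HUMAN RULINGS D-0062 ∕ D-0149), WIDTH SEAT `pub-ymgap-dag-n12-w3` g2 (node N12 = [B15]; key K1⁷ `stmt-QuantumFields-20542`, `--supports … --as helper`; count-neutral).  THEOREMS ONLY.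
WHY.  The `𝐁`-adapted hierarchical axial slice of `N12FlatHierAxialHndDetSet` («for every member site `y ∈ Γ_j`, `j ≤ k`, and every level-`m` site `x` under `y`, `m < j`, the field `Q^{(m)}X` is
axial along the one-level comb from `emb (blockOf x)` to `x`») was shown TRANSVERSAL to the locally-constant flat null space ((β)♭, files 8–12 of this seat).  The other half of a gauge fixing —
that the slice is REACHED from every field by a pure gauge ([Balaban1985RegularSpaces] p. 79 «the conditions (1.19) determine uniquely an element in each orbit of the subgroup (1.14)») — is
what the implicit-function ∕ `honto` side (dag-n12-w1, N07) and the nonlinear gauge-fixing map of dag-n12-w6's (σ1)–(σ4) linearise to.  HERE, for the record's `𝐁_k(Z) = Bj M₁ Z k`: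
★★★ `exists_topGauge_sub_grad_hierAxial_Bj` — for every fine matrix field `X` there is `ψ` with `ψ = 0` at EVERY member centre `embIter j y`, `y ∈ Γ_j`, `j ≤ k`, and `X − dψ` in the slice.
PROOF (patching, no new induction): `N12FlatIterAxialRepr.exists_centreGauge_sub_grad_iterAxial` gives for each level `j` a WHOLE-LATTICE representative potential `Ψ_j` (iterated-axial below
`j`, zero at all `j`-fold centres); put `ψ(z) := Ψ_{n(z)}(z)` with `n(z)` the last scale of `z` (`N12FlatHndConnLetter` §3) — the block towers of the members are pairwise disjoint and the
tower of `y ∈ Γ_j` consists exactly of the fine sites of last scale `j` under `y` (§1 `findGreatest_eq_of_iterBlockOf_mem_Bj`), and the slice condition at `(y, m, x)` only reads the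
potential at the two fine sites `embIter m x`, `embIter m (emb (blockOf x))` of that tower (§2 `hierAxialAt_congr`).  ★★ `grad_eq_zero_of_hierAxial_of_top_eq_zero` (any determining set
with (Cov)): a pure gauge `dφ` in the slice with `φ = 0` at every member centre is `0` (`eq_top_of_hierAxial_under`) — uniqueness of the representative.

CONTENTS.  §1 `findGreatest_eq_of_iterBlockOf_mem_Bj`; §2 `hierAxialAt_congr` (the slice condition at `(m, x)` for `X − dψ` depends on `ψ` only through `ψ(embIter m x)`, `ψ(embIter m (emb (blockOf x)))`),
`hierAxialAt_grad_iff`; §3 ★★★ `exists_topGauge_sub_grad_hierAxial_Bj`; §4 ★★ `grad_eq_zero_of_hierAxial_of_top_eq_zero` (any `𝐁` with (Cov)), `hierAxialAt_grad_sub_of_both`, ★★ `grad_unique_of_hierAxial_Bj`;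
§5 linearity (the slice is a `ℂ`-submodule, pointwise in `(m, x)`): `walkSum_smul`, `linAvg_smul`, `iterLin_smul` (companion of `Prop7CombGauge.iterLin_add`), `axialT_ofAdd_iterLin_zero ∕ _add ∕ _smul`.

HONEST FRAMING.  Linear algebra at the FLAT configuration (the linearisation of print's nonlinear axial gauge fixing, not the fixing itself); hypotheses `1 ≤ M₁`, `1 ≤ k ≤ m + K`, cover
divisibility; nothing quantitative ((1.25)-type bounds on the representative are NOT here); nothing of Bałaban's estimates asserted; N12 NOT discharged; K1⁷ NOT closed; counts unmoved
(typed 28∕28 · discharged 5∕27); one finite 𝕋⁴ programme at fixed ε — R4 closes the conditional rung `BalabanLadder.UV` only; the Yang–Mills mass gap (Clay) is NOT proved by any of this;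
nothing continuum ∕ ℝ⁴ ∕ OS.
-/

noncomputable section

namespace Summit.QuantumFields.YangMills.BalabanUVNodes.N12FlatHierAxialRepr

open Literature.MathematicalPhysics.QuantumFieldTheory.Balaban1983to89
open BlockAveragingEMLLinearised (linAvg)
open B15DeterminingSets
open B5Eq118OneStroke (iterBlockOf)
open B10Eq27TorusAxialLog (axialT)
open Literature.MathematicalPhysics.QuantumFieldTheory.Balaban1983to89.B14.Eq213DetSet (Bj Bj_zero Bj_mid Bj_top maxDomT maxDomT_antitone isBlockUnion_maxDomT)
open Literature.MathematicalPhysics.QuantumFieldTheory.Balaban1983to89.B14.Eq213MaximalDomains (side)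
open Literature.MathematicalPhysics.QuantumFieldTheory.BalabanImbrieJaffe1984to88.BIJ88RT51Background (iterBlockOf_embIter)
open Summit.QuantumFields.YangMills.Theorems.Prop7CombGauge (iterLin_add walkSum_add)
open Summit.QuantumFields.YangMills.Theorems.Prop7AvgLinearisation (iterLin_grad)
open N12FlatIterAxialHnd (axialT_ofAdd_grad_eq_one_iff)
open N12FlatIterAxialRepr (iterBlockOf_embIter_eq_of_lt axialT_ofAdd_add_eq_one exists_centreGauge_sub_grad_iterAxial)
open N12FlatHierAxialHndDetSet (eq_top_of_hierAxial_under)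
open N12FlatHndConnLetter (mem_iff_centre_mem mem_maxDomT_of_findGreatest_eq not_mem_maxDomT_of_findGreatest_lt findGreatest_embIter_of_mem_Bj)

variable {P : Params}

/-! ## §1 The block tower of a member of `𝐁_k(Z)` consists of the fine sites of that last scale -/

open scoped Classical

section Tower

variable {M₁ : ℕ} {Z : Set (Site P 0)} {k : ℕ}

/-- **UNDER A MEMBER OF LEVEL `j`, THE LAST SCALE IS `j`**: if the `j`-block of `z` belongs to `Γ_j` (`j ≤ k`) then `n(z) = j` — the block towers of the members of `𝐁_k(Z)` are the level sets of
the last scale refined by blocks (`Γ_j`-blocks lie in `Ω_j ∖ Ω_{j+1}`, block unions by cover divisibility). [cite: Balaban1988Convergent, (2.2) p.255, (2.13) pp.256-257] -/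
theorem findGreatest_eq_of_iterBlockOf_mem_Bj (hM : 1 ≤ M₁) (hk : 1 ≤ k) (hkK : k ≤ P.m + P.K) (hdiv : side P.L M₁ k ∣ P.sitesPerDir 0)
    {j : ℕ} (hj : j ≤ k) {z : Site P 0} (hz : iterBlockOf j z ∈ (Bj M₁ Z k : DetSet P) j) :
    Nat.findGreatest (fun i => z ∈ maxDomT M₁ Z i) k = j := by
  rw [Nat.findGreatest_eq_iff]
  rcases Nat.eq_zero_or_pos j with rfl | hpos
  · rw [Bj_zero hk, B5Eq118OneStroke.iterBlockOf_zero] at hz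
    exact ⟨hj, fun h => (h rfl).elim, fun n hn hnk hmem => hz (maxDomT_antitone hM Z (show 1 ≤ n by omega) hmem)⟩
  · have hin : z ∈ maxDomT M₁ Z j → ∀ ⦃n⦄, j < n → n ≤ k → z ∈ maxDomT M₁ Z n → z ∈ maxDomT M₁ Z (j + 1) :=
      fun _ n hn _ hmem => maxDomT_antitone hM Z (show j + 1 ≤ n by omega) hmem
    rcases hj.lt_or_eq with hlt | rfl
    · rw [Bj_mid hpos hlt] at hz
      have hzj : z ∈ maxDomT M₁ Z j := (mem_iff_centre_mem (isBlockUnion_maxDomT hM hdiv hpos hj (hj.trans hkK)) z).2 (mem_pts.1 hz.1)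
      refine ⟨hj, fun _ => hzj, fun n hn hnk hmem => hz.2 (mem_pts.2 ?_)⟩
      exact (mem_iff_centre_mem (B14.Eq213DetSet.isBlockUnion_maxDomT_succ hM hdiv (show j + 1 ≤ k from hlt) (hj.trans hkK)) z).1 (hin hzj hn hnk hmem)
    · rw [Bj_top] at hz
      exact ⟨le_rfl, fun _ => (mem_iff_centre_mem (isBlockUnion_maxDomT hM hdiv hpos le_rfl hkK) z).2 (mem_pts.1 hz), fun n hn hnk => absurd hnk (by omega)⟩

end Tower

/-! ## §2 The slice condition at one pair `(m, x)` reads the potential at two fine sites only -/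

section Congr

variable {n : Type*}
variable (Q : (i : ℕ) → (PBond P 0 → Matrix n n ℂ) → PBond P i → Matrix n n ℂ)
  (hQ0 : ∀ Y, Q 0 Y = Y) (hQs : ∀ (i : ℕ) (Y : PBond P 0 → Matrix n n ℂ) (c : PBond P (i + 1)), Q (i + 1) Y c = linAvg (Q i Y) c)
include hQ0 hQs

/-- The one-level comb-axiality of `Q^{(m)}(dχ)` from `emb (blockOf x)` to `x` says exactly `χ(embIter m x) = χ(embIter m (emb (blockOf x)))` (`iterLin_grad` + telescoping).
[cite: Balaban1985RegularSpaces, (1.19) p.79; Balaban1984PropagatorsI, (1.10) p.19] -/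
theorem hierAxialAt_grad_iff {m : ℕ} (χ : Site P 0 → Matrix n n ℂ) (x : Site P m) :
    axialT (fun b : PBond P m => Multiplicative.ofAdd (Q m (fun e : PBond P 0 => χ e.tgt - χ e.src) b)) (emb (blockOf x)) x = 1 ↔
      χ (embIter m x) = χ (embIter m (emb (blockOf x))) := by
  rw [show Q m (fun e : PBond P 0 => χ e.tgt - χ e.src) = fun b : PBond P m => χ (embIter m b.tgt) - χ (embIter m b.src) from
    funext fun b => iterLin_grad Q hQ0 hQs (fun i ψ w => ψ (embIter i w)) (fun ψ => rfl) (fun i ψ w => rfl) χ m b]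
  exact axialT_ofAdd_grad_eq_one_iff (fun w : Site P m => χ (embIter m w)) _ _

/-- ★ **LOCALITY OF THE SLICE CONDITION IN THE POTENTIAL**: if two potentials agree at the fine sites `embIter m x` and `embIter m (emb (blockOf x))`, then `X − dψ` is comb-axial at `(m, x)` iff
`X − dψ'` is (`X − dψ = (X − dψ') + d(ψ' − ψ)` and the second summand is axial there by `hierAxialAt_grad_iff`). [cite: Balaban1985RegularSpaces, (1.19) p.79] -/
theorem hierAxialAt_congr {m : ℕ} (X : PBond P 0 → Matrix n n ℂ) {ψ ψ' : Site P 0 → Matrix n n ℂ} (x : Site P m)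
    (h₁ : ψ (embIter m x) = ψ' (embIter m x)) (h₂ : ψ (embIter m (emb (blockOf x))) = ψ' (embIter m (emb (blockOf x))))
    (hax : axialT (fun b : PBond P m => Multiplicative.ofAdd (Q m (fun e : PBond P 0 => X e - (ψ' e.tgt - ψ' e.src)) b)) (emb (blockOf x)) x = 1) :
    axialT (fun b : PBond P m => Multiplicative.ofAdd (Q m (fun e : PBond P 0 => X e - (ψ e.tgt - ψ e.src)) b)) (emb (blockOf x)) x = 1 := by
  have hsplit : (fun e : PBond P 0 => X e - (ψ e.tgt - ψ e.src)) =
      fun e => (X e - (ψ' e.tgt - ψ' e.src)) + ((fun z => ψ' z - ψ z) e.tgt - (fun z => ψ' z - ψ z) e.src) := by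
    funext e; simp only; abel
  have hfun : (fun b : PBond P m => Multiplicative.ofAdd (Q m (fun e : PBond P 0 => X e - (ψ e.tgt - ψ e.src)) b)) =
      fun b => Multiplicative.ofAdd (Q m (fun e : PBond P 0 => X e - (ψ' e.tgt - ψ' e.src)) b +
        Q m (fun e : PBond P 0 => (fun z => ψ' z - ψ z) e.tgt - (fun z => ψ' z - ψ z) e.src) b) :=
    funext fun b => by rw [hsplit, iterLin_add Q hQ0 hQs]
  rw [hfun]
  refine axialT_ofAdd_add_eq_one hax ((hierAxialAt_grad_iff Q hQ0 hQs (fun z => ψ' z - ψ z) x).2 ?_)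
  show ψ' (embIter m x) - ψ (embIter m x) = ψ' (embIter m (emb (blockOf x))) - ψ (embIter m (emb (blockOf x)))
  rw [h₁, h₂, sub_self, sub_self]

end Congr

/-! ## §3 ★★★ Existence of the `𝐁_k(Z)`-adapted hierarchical axial representative, top-pinned -/

section Existence

variable {n : Type*} {M₁ : ℕ} {Z : Set (Site P 0)} {k : ℕ}

/-- ★★★ **EVERY FINE FIELD HAS A `𝐁_k(Z)`-ADAPTED HIERARCHICAL AXIAL REPRESENTATIVE MODULO A TOP-PINNED PURE GAUGE** ([Balaban1985RegularSpaces] (1.19), existence half, linearised at the flat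
configuration, region by region from its own scale as in [III] (2.13)): for `1 ≤ M₁`, `1 ≤ k ≤ m + K`, cover divisibility, and every fine matrix field `X` there is a potential `ψ` with
`ψ(embIter j y) = 0` for every member `y ∈ Γ_j`, `j ≤ k`, such that for every such `y`, every `m < j` and every level-`m` site `x` under `y`, the field `Q^{(m)}(X − dψ)` is axial along the
one-level comb from `emb (blockOf x)` to `x`.  `ψ(z) := Ψ_{n(z)}(z)` patches the whole-lattice iterated-axial representatives `Ψ_j` of `N12FlatIterAxialRepr.exists_centreGauge_sub_grad_iterAxial`
along the last scale. [cite: Balaban1985RegularSpaces, (1.14) p.78, (1.19) p.79; Balaban1988Convergent, (2.13) pp.256-257; Balaban1985Variational, (16)-(18) p.280] -/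
theorem exists_topGauge_sub_grad_hierAxial_Bj (hM : 1 ≤ M₁) (hk : 1 ≤ k) (hkK : k ≤ P.m + P.K) (hdiv : side P.L M₁ k ∣ P.sitesPerDir 0)
    (Q : (i : ℕ) → (PBond P 0 → Matrix n n ℂ) → PBond P i → Matrix n n ℂ)
    (hQ0 : ∀ Y, Q 0 Y = Y) (hQs : ∀ (i : ℕ) (Y : PBond P 0 → Matrix n n ℂ) (c : PBond P (i + 1)), Q (i + 1) Y c = linAvg (Q i Y) c)
    (X : PBond P 0 → Matrix n n ℂ) :
    ∃ ψ : Site P 0 → Matrix n n ℂ, (∀ j, j ≤ k → ∀ y ∈ (Bj M₁ Z k : DetSet P) j, ψ (embIter j y) = 0) ∧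
      ∀ j, j ≤ k → ∀ y ∈ (Bj M₁ Z k : DetSet P) j, ∀ m, m < j → ∀ x : Site P m, iterBlockOf j (embIter m x) = y →
        axialT (fun b : PBond P m => Multiplicative.ofAdd (Q m (fun e : PBond P 0 => X e - (ψ e.tgt - ψ e.src)) b)) (emb (blockOf x)) x = 1 := by
  -- the whole-lattice iterated-axial representatives, one per level `j ≤ m + K`
  choose! Ψ hΨ using fun j (hj : j ≤ P.m + P.K) => exists_centreGauge_sub_grad_iterAxial Q hQ0 hQs j hj X
  -- patch them along the last scale
  refine ⟨fun z => Ψ (Nat.findGreatest (fun i => z ∈ maxDomT M₁ Z i) k) z, fun j hj y hy => ?_, fun j hj y hy m hm x hx => ?_⟩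
  · show Ψ (Nat.findGreatest (fun i => embIter j y ∈ maxDomT M₁ Z i) k) (embIter j y) = 0
    rw [findGreatest_embIter_of_mem_Bj hM hk hj hy]
    exact (hΨ j (hj.trans hkK)).1 y
  · have hjK : j ≤ P.m + P.K := hj.trans hkK
    -- both fine sites read by the slice condition lie under `y`, hence have last scale `j`
    have hx' : iterBlockOf j (embIter m (emb (blockOf x))) = y := by rw [← iterBlockOf_embIter_eq_of_lt hjK hm x, hx]
    have h₁ := findGreatest_eq_of_iterBlockOf_mem_Bj hM hk hkK hdiv hj (show iterBlockOf j (embIter m x) ∈ (Bj M₁ Z k : DetSet P) j from hx.symm ▸ hy)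
    have h₂ := findGreatest_eq_of_iterBlockOf_mem_Bj hM hk hkK hdiv hj (show iterBlockOf j (embIter m (emb (blockOf x))) ∈ (Bj M₁ Z k : DetSet P) j from hx'.symm ▸ hy)
    refine hierAxialAt_congr Q hQ0 hQs X x (ψ := fun z => Ψ (Nat.findGreatest (fun i => z ∈ maxDomT M₁ Z i) k) z) ?_ ?_ ((hΨ j hjK).2 m hm x)
    · show Ψ (Nat.findGreatest (fun i => embIter m x ∈ maxDomT M₁ Z i) k) (embIter m x) = Ψ j (embIter m x)
      rw [h₁]
    · show Ψ (Nat.findGreatest (fun i => embIter m (emb (blockOf x)) ∈ maxDomT M₁ Z i) k) (embIter m (emb (blockOf x))) = Ψ j (embIter m (emb (blockOf x)))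
      rw [h₂]

end Existence

/-! ## §4 ★★ Uniqueness: a top-pinned pure gauge in the slice vanishes -/

section Uniqueness

variable {n : Type*}

/-- ★★ **A TOP-PINNED PURE GAUGE IN THE `𝐁`-ADAPTED SLICE IS ZERO** (any determining set with coverage (Cov); [Balaban1985RegularSpaces] (1.19), uniqueness half, linearised): if `dφ` is
hierarchically axial and `φ(embIter j y) = 0` at every member `y ∈ Γ_j`, `j ≤ k`, then `dφ = 0` — each fine site takes the value of its top (`eq_top_of_hierAxial_under`).
[cite: Balaban1985RegularSpaces, (1.14) p.78, (1.19) p.79; Balaban1988Convergent, (2.13) pp.256-257] -/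
theorem grad_eq_zero_of_hierAxial_of_top_eq_zero
    (Q : (i : ℕ) → (PBond P 0 → Matrix n n ℂ) → PBond P i → Matrix n n ℂ)
    (hQ0 : ∀ Y, Q 0 Y = Y) (hQs : ∀ (i : ℕ) (Y : PBond P 0 → Matrix n n ℂ) (c : PBond P (i + 1)), Q (i + 1) Y c = linAvg (Q i Y) c)
    {k : ℕ} (hk : k ≤ P.m + P.K) (𝔹 : DetSet P) (hcov : ∀ z : Site P 0, ∃ j, j ≤ k ∧ iterBlockOf j z ∈ 𝔹 j)
    (φ : Site P 0 → Matrix n n ℂ) (htop : ∀ j, j ≤ k → ∀ y ∈ 𝔹 j, φ (embIter j y) = 0)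
    (hax : ∀ j, j ≤ k → ∀ y ∈ 𝔹 j, ∀ m, m < j → ∀ x : Site P m, iterBlockOf j (embIter m x) = y →
      axialT (fun b : PBond P m => Multiplicative.ofAdd (Q m (fun e : PBond P 0 => φ e.tgt - φ e.src) b)) (emb (blockOf x)) x = 1) :
    ∀ b : PBond P 0, φ b.tgt - φ b.src = 0 := by
  have hzero : ∀ z : Site P 0, φ z = 0 := fun z => by
    obtain ⟨j, hj, hy⟩ := hcov z
    rw [eq_top_of_hierAxial_under Q hQ0 hQs (hj.trans hk) φ _ (hax j hj _ hy) rfl]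
    exact htop j hj _ hy
  intro b
  rw [hzero, hzero, sub_self]

variable {M₁ : ℕ} {Z : Set (Site P 0)} {k : ℕ}

/-- Two corrected fields `X − dψ`, `X − dψ'` both comb-axial at `(m, x)` ⟹ the pure gauge `d(ψ − ψ')` is comb-axial there (additivity of `Q^{(m)}` and of comb sums).
[cite: Balaban1985RegularSpaces, (1.19) p.79 (bookkeeping)] -/
theorem hierAxialAt_grad_sub_of_both
    (Q : (i : ℕ) → (PBond P 0 → Matrix n n ℂ) → PBond P i → Matrix n n ℂ)
    (hQ0 : ∀ Y, Q 0 Y = Y) (hQs : ∀ (i : ℕ) (Y : PBond P 0 → Matrix n n ℂ) (c : PBond P (i + 1)), Q (i + 1) Y c = linAvg (Q i Y) c)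
    {m : ℕ} (X : PBond P 0 → Matrix n n ℂ) (ψ ψ' : Site P 0 → Matrix n n ℂ) (x : Site P m)
    (hax : axialT (fun b : PBond P m => Multiplicative.ofAdd (Q m (fun e : PBond P 0 => X e - (ψ e.tgt - ψ e.src)) b)) (emb (blockOf x)) x = 1)
    (hax' : axialT (fun b : PBond P m => Multiplicative.ofAdd (Q m (fun e : PBond P 0 => X e - (ψ' e.tgt - ψ' e.src)) b)) (emb (blockOf x)) x = 1) :
    axialT (fun b : PBond P m => Multiplicative.ofAdd (Q m (fun e : PBond P 0 => (fun z => ψ z - ψ' z) e.tgt - (fun z => ψ z - ψ' z) e.src) b)) (emb (blockOf x)) x = 1 := by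
  have hsplit : (fun e : PBond P 0 => X e - (ψ' e.tgt - ψ' e.src)) =
      fun e => (X e - (ψ e.tgt - ψ e.src)) + ((fun z => ψ z - ψ' z) e.tgt - (fun z => ψ z - ψ' z) e.src) := by
    funext e; simp only; abel
  have hfun : (fun b : PBond P m => Multiplicative.ofAdd (Q m (fun e : PBond P 0 => X e - (ψ' e.tgt - ψ' e.src)) b)) =
      fun b => Multiplicative.ofAdd (Q m (fun e : PBond P 0 => X e - (ψ e.tgt - ψ e.src)) b +
        Q m (fun e : PBond P 0 => (fun z => ψ z - ψ' z) e.tgt - (fun z => ψ z - ψ' z) e.src) b) :=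
    funext fun b => by rw [hsplit, iterLin_add Q hQ0 hQs]
  rw [hfun, N12FlatCombAxialRepr.axialT_ofAdd_eq_one_iff, walkSum_add, (N12FlatCombAxialRepr.axialT_ofAdd_eq_one_iff _ _ _).1 hax, zero_add] at hax'
  exact (N12FlatCombAxialRepr.axialT_ofAdd_eq_one_iff _ _ _).2 hax'

variable {M₁ : ℕ} {Z : Set (Site P 0)} {k : ℕ}

/-- ★★ **UNIQUENESS OF THE `𝐁_k(Z)`-ADAPTED REPRESENTATIVE**: two potentials vanishing at every member centre of `𝐁_k(Z)` whose corrected fields `X − dψ`, `X − dψ'` are both in the slice give the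
same pure gauge: `dψ = dψ'` ((Cov) for `Bj` by `N12FlatHndRecordLetters.hcov_Bj`). [cite: Balaban1985RegularSpaces, (1.19) p.79; Balaban1988Convergent, (2.13) pp.256-257] -/
theorem grad_unique_of_hierAxial_Bj (hM : 1 ≤ M₁) (hk : 1 ≤ k) (hkK : k ≤ P.m + P.K) (hdiv : side P.L M₁ k ∣ P.sitesPerDir 0)
    (Q : (i : ℕ) → (PBond P 0 → Matrix n n ℂ) → PBond P i → Matrix n n ℂ)
    (hQ0 : ∀ Y, Q 0 Y = Y) (hQs : ∀ (i : ℕ) (Y : PBond P 0 → Matrix n n ℂ) (c : PBond P (i + 1)), Q (i + 1) Y c = linAvg (Q i Y) c)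
    (X : PBond P 0 → Matrix n n ℂ) {ψ ψ' : Site P 0 → Matrix n n ℂ}
    (h0 : ∀ j, j ≤ k → ∀ y ∈ (Bj M₁ Z k : DetSet P) j, ψ (embIter j y) = 0) (h0' : ∀ j, j ≤ k → ∀ y ∈ (Bj M₁ Z k : DetSet P) j, ψ' (embIter j y) = 0)
    (hax : ∀ j, j ≤ k → ∀ y ∈ (Bj M₁ Z k : DetSet P) j, ∀ m, m < j → ∀ x : Site P m, iterBlockOf j (embIter m x) = y →
      axialT (fun b : PBond P m => Multiplicative.ofAdd (Q m (fun e : PBond P 0 => X e - (ψ e.tgt - ψ e.src)) b)) (emb (blockOf x)) x = 1)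
    (hax' : ∀ j, j ≤ k → ∀ y ∈ (Bj M₁ Z k : DetSet P) j, ∀ m, m < j → ∀ x : Site P m, iterBlockOf j (embIter m x) = y →
      axialT (fun b : PBond P m => Multiplicative.ofAdd (Q m (fun e : PBond P 0 => X e - (ψ' e.tgt - ψ' e.src)) b)) (emb (blockOf x)) x = 1) :
    ∀ b : PBond P 0, ψ b.tgt - ψ b.src = ψ' b.tgt - ψ' b.src := by
  -- the difference `χ = ψ − ψ'` is top-pinned and `dχ` is in the slice
  have hχ := grad_eq_zero_of_hierAxial_of_top_eq_zero Q hQ0 hQs hkK (Bj M₁ Z k) (N12FlatHndRecordLetters.hcov_Bj hM hk hkK hdiv) (fun z => ψ z - ψ' z)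
    (fun j hj y hy => by show ψ _ - ψ' _ = 0; rw [h0 j hj y hy, h0' j hj y hy, sub_self])
    (fun j hj y hy m hm x hx => hierAxialAt_grad_sub_of_both Q hQ0 hQs X ψ ψ' x (hax j hj y hy m hm x hx) (hax' j hj y hy m hm x hx))
  intro b
  exact sub_eq_zero.1 (by rw [← hχ b]; abel)

end Uniqueness

/-! ## §5 Linearity: the slice conditions are closed under `0`, `+`, scalars (the slice is a `ℂ`-submodule, pointwise in `(m, x)`) -/

section Linear

open BlockAveragingEMLLinearised (walkSum walkSum_nil walkSum_cons)

variable {n : Type*}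

/-- Comb sums are `ℂ`-homogeneous in the field. [cite: Balaban1984PropagatorsI, (1.8) p.19 (bookkeeping)] -/
theorem walkSum_smul {j : ℕ} (c : ℂ) (Y : PBond P j → Matrix n n ℂ) :
    ∀ γ : List (T4Continuum.LStep P j), walkSum (fun b => c • Y b) γ = c • walkSum Y γ
  | [] => by simp [walkSum_nil]
  | s :: γ => by rw [walkSum_cons, walkSum_cons, walkSum_smul c Y γ]; split_ifs <;> simp [smul_add, smul_neg]

/-- The linearised one-step average (0.4)♭ is `ℂ`-homogeneous. [cite: Balaban1985Averaging, (124)-(125) p.36 (bookkeeping)] -/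
theorem linAvg_smul {j : ℕ} (c : ℂ) (Y : PBond P j → Matrix n n ℂ) (b : PBond P (j + 1)) :
    linAvg (fun e => c • Y e) b = c • linAvg Y b := by
  simp only [linAvg, walkSum_smul, ← smul_add, ← smul_sub, ← Finset.smul_sum]
  rw [smul_comm]

variable (Q : (i : ℕ) → (PBond P 0 → Matrix n n ℂ) → PBond P i → Matrix n n ℂ)
  (hQ0 : ∀ Y, Q 0 Y = Y) (hQs : ∀ (i : ℕ) (Y : PBond P 0 → Matrix n n ℂ) (c : PBond P (i + 1)), Q (i + 1) Y c = linAvg (Q i Y) c)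
include hQ0 hQs

/-- Any family with `Q^{(0)} = id`, `Q^{(i+1)} = Q₁∘Q^{(i)}` is `ℂ`-homogeneous (companion of `Prop7CombGauge.iterLin_add`). [cite: Balaban1985Averaging, (124)-(125) p.36] -/
theorem iterLin_smul (c : ℂ) (Y : PBond P 0 → Matrix n n ℂ) : ∀ (k : ℕ) (b : PBond P k), Q k (fun e => c • Y e) b = c • Q k Y b := by
  intro k
  induction k with
  | zero => intro b; rw [hQ0, hQ0]
  | succ k ih => intro b; rw [hQs, hQs, show Q k (fun e => c • Y e) = fun e => c • Q k Y e from funext ih, linAvg_smul]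

/-- The zero field is comb-axial everywhere at every level (`Q^{(m)}0 = 0`). [cite: Balaban1985RegularSpaces, (1.19) p.79 (bookkeeping)] -/
theorem axialT_ofAdd_iterLin_zero {m : ℕ} (y x : Site P m) :
    axialT (fun b : PBond P m => Multiplicative.ofAdd (Q m (fun _ : PBond P 0 => (0 : Matrix n n ℂ)) b)) y x = 1 := by
  have h0 : Q m (fun _ : PBond P 0 => (0 : Matrix n n ℂ)) = fun b => (0 : ℂ) • Q m (fun _ : PBond P 0 => (0 : Matrix n n ℂ)) b := by
    rw [← funext (iterLin_smul Q hQ0 hQs (0 : ℂ) (fun _ : PBond P 0 => (0 : Matrix n n ℂ)) m)]; simp only [smul_zero]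
  rw [N12FlatCombAxialRepr.axialT_ofAdd_eq_one_iff, h0, walkSum_smul, zero_smul]

/-- Comb-axiality of `Q^{(m)}·` at `(y, x)` is additive in the fine field. [cite: Balaban1985RegularSpaces, (1.19) p.79 (bookkeeping)] -/
theorem axialT_ofAdd_iterLin_add {m : ℕ} {X Y : PBond P 0 → Matrix n n ℂ} {y x : Site P m}
    (hX : axialT (fun b : PBond P m => Multiplicative.ofAdd (Q m X b)) y x = 1) (hY : axialT (fun b : PBond P m => Multiplicative.ofAdd (Q m Y b)) y x = 1) :
    axialT (fun b : PBond P m => Multiplicative.ofAdd (Q m (fun e => X e + Y e) b)) y x = 1 := by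
  rw [show (fun b : PBond P m => Multiplicative.ofAdd (Q m (fun e => X e + Y e) b)) = fun b => Multiplicative.ofAdd (Q m X b + Q m Y b) from
    funext fun b => by rw [iterLin_add Q hQ0 hQs]]
  exact axialT_ofAdd_add_eq_one hX hY

/-- Comb-axiality of `Q^{(m)}·` at `(y, x)` is `ℂ`-homogeneous in the fine field. [cite: Balaban1985RegularSpaces, (1.19) p.79 (bookkeeping)] -/
theorem axialT_ofAdd_iterLin_smul {m : ℕ} (c : ℂ) {X : PBond P 0 → Matrix n n ℂ} {y x : Site P m}
    (hX : axialT (fun b : PBond P m => Multiplicative.ofAdd (Q m X b)) y x = 1) :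
    axialT (fun b : PBond P m => Multiplicative.ofAdd (Q m (fun e => c • X e) b)) y x = 1 := by
  rw [N12FlatCombAxialRepr.axialT_ofAdd_eq_one_iff] at hX ⊢
  rw [funext (iterLin_smul Q hQ0 hQs c X m), walkSum_smul, hX, smul_zero]

end Linear

end Summit.QuantumFields.YangMills.BalabanUVNodes.N12FlatHierAxialRepr

end
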